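import Summits.BirchSwinnertonDyer.BirchSwinnertonDyer.Theorems.KatoDescentPotSupersingularWildFineSelmerOrdinaryUnitAnchor
import Literature.NumberTheory.EllipticCurves.Wuthrich2014.SurjectiveMultiplicativeDivisibility
import HarnessLib

/-!
# Route `KatoDescentPotSupersingular` (rung K9, cell `bsd-potss`): MULTIPLICATIVE BIG-IMAGE ANCHORS for
# the congruence road to the Conj-A crux `WildFineSelmerCoatesSujatha` (item stmt-BirchSwinnertonDyer-19386)
# — the KERNEL LINK «anchor `E′` multiplicative at `p` with surjective `ρ_{E′,p^∞}` + ONE unit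
# coefficient of `ϖ·L_p(E′)` ⟹ `Sel_{p^∞}(E′/ℚ^cyc)[p]` finite» below the tree's named fact
# `Wuthrich2014.kato_charIdeal_dvd_multiplicative_of_surjective` (Kato's divisibility at an odd
# multiplicative prime, Wuthrich 2014 Thm. 3 / Cor. 19 "proven by Kato"), and the per-row road
# «Upper at `W` ⟸ one congruent multiplicative big-image anchor + a `μ`-certificate»; ROUTE-FREE
# (a `--supports … --as helper` file; seat `bsd-potss-conjA-anchor` g2; nothing booked, BSD is not
# proved by any of this, item 19386 is NOT closed)

WHY (the Elkies rows). The anchor census of seat `bsd-potss-conjA-anchor` g0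
(HOME/conjA-anchor/FINDING-19386-19413-conjA-anchor-g0.md §1c) isolated, inside the K9 Conj-A crux
(wild `3`, `r_an = 0`, `W[3]` irreducible, `3`-adic tower NOT onto), the 20 "Elkies" rows: `ρ̄_{W,3}`
is ONTO `GL₂(𝔽₃)` but `ρ_{W,9}` is not. A congruent anchor `W′` (`W′[3] ≃ W[3]`) then has surjective
`ρ̄_{W′,3}` as well, so it admits no `3`-isogeny and has no CM (a CM curve's mod-`3` image lies in
the normaliser of a Cartan subgroup or in a Borel subgroup): the CM roads
(`…WildFineSelmerCMAnchor`, `…WildFineSelmerCMSupersingularAnchor`, `…SupersingularCMAnchor`) and the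
reducible roads are void on these rows, and the census found NO congruent partner of conductor
`≤ 5·10⁵` with good reduction at `3` (so the good-ordinary / supersingular unit roads are void at
that search depth too) — but 13 of the 20 rows have a congruent partner with MULTIPLICATIVE reduction
at `3`. For a multiplicative anchor whose `3`-adic representation is onto `GL₂(ℤ₃)` the integral
statement in print is Kato's divisibility `char_Λ X(E′/ℚ_∞) ∣ (ϖ·L_3(E′))` (times `T` at a split
prime), transcribed in the tree from Wuthrich 2014 (Thm. 3 + Cor. 19, first case of the proof,
"proven by Kato") as the named fact `Wuthrich2014.kato_charIdeal_dvd_multiplicative_of_surjective` —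
stated over `ℚ_∞` (the `ω⁰`-branch), for every prime `p ≠ 2`, with the image hypothesis spelled
`∀ n, ρ̄_{E′,p^n}` surjective. (The planner's sizing note "ℚ_∞ ⊂ ℚ(ζ_{3^∞}) prime-to-3 descent +
both ω-branches" refers to the `…CyclotomicPrime` twins of that fact; the `ℚ_∞`-form makes the
descent unnecessary: NO restriction/corestriction argument is used below.)

THE LINK (this file):

* §0 `muInvariant_eq_zero_of_mem_charIdeal_of_isUnit_coeff` — for a finitely generated torsion
  `Λ`-module `M`: if SOME element `g` of `char_Λ M` (not necessarily a generator) has a unit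
  coefficient, then `μ(M) = 0` (`char M = (c)` is principal, `c ∣ g`, and `μ ≠ 0 ⟺ p ∣ c`, which would
  force `p ∣ g` coefficientwise). The DIVISIBILITY form of the tree's
  `muInvariant_eq_zero_iff_exists_isUnit_coeff_of_charIdeal_eq_span` — what a one-sided main-conjecture
  divisibility (Kato) feeds, as opposed to an equality (Rubin, Pollack–Rubin, Perrin-Riou–Schneider).
* §1 `finite_selmerInfty_pTorsion_of_multiplicative_surjective_of_unitCoeff` — for `W′/ℚ` globally
  minimal, `p ≠ 2` of MULTIPLICATIVE reduction, `ρ̄_{W′,p^n}` surjective for all `n`, the newform `f`,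
  `ϖ` with `ϖ·Ω_{W′} = Ω⁺_f`, THE `p`-adic `L`-function `L` of `f` at `p` (`IsMultPAdicLFunctionOf f p (-1) L`
  at a non-split prime, `IsSplitMultPAdicLFunctionOf f p L` at a split one — both hypotheses are
  carried, guarded by the reduction type, so one statement serves both cases) and ONE index `n` with
  `‖coeff_n(ϖ·L)‖_p = 1` (a `μ`-CERTIFICATE): `Sel_{p^∞}(W′/ℚ_∞)[p]` is finite for EVERY cyclotomic
  `ℤ_p`-extension datum. Chain, all in the kernel below the ONE named fact: the normalised cyclotomic
  pair `(κ₀, γ₀)`; `X₀ = Hom(Sel_∞, ℚ/ℤ)` (`selmerDualData`, f.g./`Λ` by `module_finite_of_isCyclotomic`);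
  the fact: `X₀` torsion and `ι g = ϖ·L` (resp. `ι(T·g) = ϖ·L`) for some `g ∈ char X₀`; the certificate
  reads `coeff_n g ∈ ℤ_pˣ` (resp. `coeff_{n-1} g`, the index `0` being excluded by `T ∣ ι(T·g)`); §0 ⟹
  `μ(X₀) = 0` ⟹ `X₀` f.g./`ℤ_p` ⟹ `X₀/p` finite ⟹ `Sel_∞[p]` finite (Pontryagin); transport along
  `ker κ₀ = ker κ` — steps (5)–(7) verbatim as in k9-c4's ordinary unit link.
* §2 `missingUpperBoundAt_wild_of_multiplicativeSurjectiveAnchor` — the per-row road: Upper at a row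
  `W` (wild `3`, `r_an = 0`, `ClassO6 W 3`, `W[3]` irreducible) ⟸ {Lim–Sujatha p445851, Kato's fine-Selmer
  reading p420034, Kato–Wuthrich multiplicative divisibility, GZK, modularity} + ONE globally minimal
  `W′` with `W′[3] ≃ W[3]` (`O6.ModPCongruent`), multiplicative at `3`, `ρ̄_{W′,3^n}` onto for all `n`,
  its newform/period data, its `3`-adic `L`-function and ONE unit coefficient — through k9-c4 g3's
  `WildFineSelmerCongruenceFact.missingUpperBoundAt_wild_of_congruent_of_finite_selmerInfty_pTorsion`.
  The crux BODY from per-row certificates of this kind is ALREADY k9-c4's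
  `WildFineSelmerCongruenceFact.wildFineSelmerCoatesSujatha_of_mixedCertificates` (its second
  disjunct is exactly the output of §1), so no class-form theorem is added.

NOT for the KT crux (19413): at `p ≥ 5` a row with `ρ_{W,p^∞}` not onto has `ρ̄_{W,p}` not onto
(Serre, tree `serre_hasSurjectiveModNGaloisRep_pow_holds`), hence so has every congruent `W′`; the
big-image hypothesis of §1 is therefore never met by an anchor of a KT row — no twin is stated.

Certificates of record (evidence, not inputs; to be produced per row by the census seat): for each of
the 13 Elkies rows with a multiplicative partner `W′` — (i) `ρ_{W′,3^∞}` onto (it suffices that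
`ρ̄_{W′,9}` be onto, Serre/Elkies), (ii) `μ(ϖ·L_3(W′)) = 0` exhibited by one unit coefficient.
CONDITIONAL on the displayed named facts (audit `proof.conditional`); no definition, no new fact, no
census number is an input.

References: [Wuthrich2014] Thm. 3, §1 p. 383, Cor. 19 (p. 398) with proof (p. 399), §3.2, §5;
[Kato2004Asterisque] Thm. 12.5 (4), 13.14, Thm. 17.4; [GreenbergLNM1716] Thm. 1.5 (PDF p. 61), §4
(PDF p. 113); [MazurTateTeitelbaum1986] §I.10, §I.12–I.14; [GreenbergVatsal2000] p. 2 (1)–(2), §2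
Prop. (2.8); [Washington1997] §13.2; [LimSujatha2018] §3 Prop. 3.2; [CoatesSujatha2005] §3;
[SerreAbelianLadic1968] Ch. IV §3.4; [Elkies2006] (mod-`3` onto, mod-`9` not).
-/

set_option autoImplicit false
-- sibling precedent (`KatoDescentPotSupersingularAssembly.lean`): the directory name repeats the summit name
set_option linter.dupNamespace false

noncomputable section

open scoped Classical AddSubgroup MatrixGroups ModularForm

universe u

namespace Summit.BirchSwinnertonDyer.BirchSwinnertonDyer.Theorems.WildFineSelmerMultiplicativeSurjectiveAnchor

open CongruenceSubgroup WeierstrassCurve Literature.NumberTheory.EllipticCurves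
  Literature.NumberTheory.EllipticCurves.ModularForms
  Literature.NumberTheory.EllipticCurves.IwasawaAlgebra
  Literature.NumberTheory.EllipticCurves.Rank1Residual
  Literature.NumberTheory.EllipticCurves.Rank1Residual.Typed
  Summit.BirchSwinnertonDyer.Rank1Residual Summit.BirchSwinnertonDyer.Rank1Residual.Additive
  Summit.BirchSwinnertonDyer.Rank1Residual.O6
  Summit.BirchSwinnertonDyer.BirchSwinnertonDyer.Theorems

/-! ## §0 `μ = 0` from ONE unit coefficient of ANY element of the characteristic ideal -/

/-- **`μ(M) = 0` from a unit coefficient of an element of `char_Λ M` (divisibility form).** For a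
finitely generated torsion `Λ = ℤ_p⟦T⟧`-module `M` and `g ∈ char_Λ(M)` with SOME coefficient a
`p`-adic unit: `μ(M) = 0`. (`char_Λ M = (c)` is principal — Washington §13.2 —, so `c ∣ g`; were
`μ(M) ≠ 0`, then `p ∣ c` in `Λ` — Greenberg–Vatsal p. 2: "`p^μ` is the exact power of `p` dividing"
the characteristic power series —, hence `p ∣ g`, i.e. every coefficient of `g` lies in `pℤ_p`.)
[cite: GreenbergVatsal2000, p. 2, (1)–(2)] [cite: Washington1997, §13.2] -/
theorem muInvariant_eq_zero_of_mem_charIdeal_of_isUnit_coeff {p : ℕ} [Fact p.Prime]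
    (M : Type*) [AddCommGroup M] [Module (IwasawaAlgebra p) M] [Module.Finite (IwasawaAlgebra p) M]
    (hM : Module.IsTorsion (IwasawaAlgebra p) M) {g : IwasawaAlgebra p}
    (hg : g ∈ Module.charIdeal (IwasawaAlgebra p) M) {n : ℕ} (hn : IsUnit (PowerSeries.coeff n g)) :
    muInvariant p M = 0 := by
  haveI : (Module.charIdeal (IwasawaAlgebra p) M).IsPrincipal := charIdeal_isPrincipal_holds p M
  obtain ⟨c, hc⟩ := Submodule.IsPrincipal.principal (Module.charIdeal (IwasawaAlgebra p) M)
  have hc' : Module.charIdeal (IwasawaAlgebra p) M = Ideal.span {c} := hc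
  rw [muInvariant_eq_zero_iff_not_C_dvd_of_charIdeal_eq_span M hM hc']
  intro hpc
  rw [hc', Ideal.mem_span_singleton] at hg
  have hpg : PowerSeries.C (p : ℤ_[p]) ∣ g := hpc.trans hg
  rw [PowerSeries.C_dvd_iff_forall_dvd_coeff] at hpg
  have h1 : ‖PowerSeries.coeff n g‖ < 1 := (PadicInt.norm_lt_one_iff_dvd _).mpr (hpg n)
  exact absurd (PadicInt.isUnit_iff.mp hn) h1.ne

/-! ## §1 Multiplicative big-image anchor + one unit coefficient ⟹ `Sel_{p^∞}(E′/ℚ_∞)[p]` finite -/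

/-- **`Sel_∞[p]` finite from an element of `char X(E/ℚ_∞)` with a unit coefficient** (the common last
leg of every `μ`-certificate road, classical Selmer group, cyclotomic datum `κ` with topological
generator `γ`): `X = Hom(Sel_∞, ℚ/ℤ)` torsion and `g ∈ char X` with `coeff_n g ∈ ℤ_pˣ` ⟹ `μ(X) = 0`
(§0) ⟹ `X` finitely generated over `ℤ_p` ⟹ `X/pX` finite ⟹ `Sel_∞[p]` finite (Pontryagin
`#(Hom(B,ℚ/ℤ)/p) = #B[p]`). [cite: GreenbergVatsal2000, p. 2 (1)–(2) and §2 Prop. (2.8)]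
[cite: Washington1997, §13.2] -/
theorem finite_selmerInfty_pTorsion_of_mem_charIdeal_of_isUnit_coeff
    (W : WeierstrassCurve ℚ) [W.IsElliptic] {p : ℕ} [Fact p.Prime]
    (κ : ZpExtension ℚ p) (hκ : κ.IsCyclotomic) {γ : Field.absoluteGaloisGroup ℚ}
    (hγ : κ.IsTopGenerator γ) (hX : (W.selmerDualData κ hγ).IsTorsion) {g : IwasawaAlgebra p}
    (hg : g ∈ (W.selmerDualData κ hγ).charIdeal) {n : ℕ} (hn : IsUnit (PowerSeries.coeff n g)) :
    Set.Finite {s : W.selmerInfty κ | p • s = 0} := by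
  set D : W.SelmerDualData κ γ := W.selmerDualData κ hγ with hDdef
  haveI hfg : Module.Finite (IwasawaAlgebra p) D.X := D.module_finite_of_isCyclotomic W κ hκ hγ
  -- `μ(X) = 0`, hence `X` finitely generated over `ℤ_p`
  have hμ : muInvariant p D.X = 0 := muInvariant_eq_zero_of_mem_charIdeal_of_isUnit_coeff D.X hX hg hn
  letI : Module ℤ_[p] D.X := Module.compHom D.X (algebraMap ℤ_[p] (IwasawaAlgebra p))
  haveI hfgZp : Module.Finite ℤ_[p] D.X :=
    X2.NonPrimitiveSelmerTorsionCard.moduleFinite_int_of_muInvariant_eq_zero p D.X hX hμ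
  -- `X/pX` finite ⟹ `Sel_∞[p]` finite (`X = Hom(Sel_∞, ℚ/ℤ)` literally)
  have hmodN : Finite (ModN D.X p) := (ZpCorank.natCard_modN_le p D.X).1
  have hmodN' : Finite (ModN (CharacterModule (W.selmerInfty κ)) p) := hmodN
  have hcard : Nat.card (ModN (CharacterModule (W.selmerInfty κ)) p) =
      Nat.card ((W.selmerInfty κ)[(p : ℤ)]) :=
    Iwasawa.natCard_modN_characterModule_eq p (W.selmerInfty κ)
  haveI hfinT : Finite ((W.selmerInfty κ)[(p : ℤ)]) := by
    apply Nat.finite_of_card_ne_zero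
    rw [← hcard]
    exact Nat.card_pos.ne'
  have hset : {s : W.selmerInfty κ | p • s = 0} =
      (((W.selmerInfty κ)[(p : ℤ)] : AddSubgroup (W.selmerInfty κ)) : Set (W.selmerInfty κ)) := by
    ext s
    rw [Set.mem_setOf_eq, SetLike.mem_coe, AddSubgroup.torsionBy.nsmul_iff]
  rw [hset]
  exact Set.toFinite _

/-- **The multiplicative big-image `μ`-certificate criterion, in the kernel below Kato's divisibility
(Wuthrich 2014 Thm. 3 / Cor. 19, "proven by Kato").** Let `E′/ℚ` be given by a globally minimal `W`,
`p ≠ 2` a prime of MULTIPLICATIVE reduction, `ρ̄_{E′,p^n}` surjective for every `n` (i.e. `ρ_{E′,p^∞}`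
onto `GL₂(ℤ_p)`), `f` the newform of `E′`, `ϖ ∈ ℚ` with `ϖ·Ω_{E′} = Ω⁺_f`, and `L` THE `p`-adic
`L`-function of `f` at `p` (`IsMultPAdicLFunctionOf f p (-1) L` if the prime is non-split,
`IsSplitMultPAdicLFunctionOf f p L` if it is split; both guards are carried). Assume the
`μ`-CERTIFICATE: some coefficient of `ϖ·L` is a `p`-adic unit. Then for every cyclotomic
`ℤ_p`-extension datum `κ`, `Sel_{p^∞}(E′/ℚ_∞)[p]` is finite (indeed `X(E′/ℚ_∞)` is finitely generated
over `ℤ_p`: `char X ∋ g` with `ι g = ϖ·L`, resp. `ι(T g) = ϖ·L`, so `μ(X) = 0`).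
[cite: Wuthrich2014, Thm. 3 and §1 (p. 383); Cor. 19 (p. 398) with proof, first case (p. 399)]
[cite: Kato2004Asterisque, Thm. 12.5 (4), 13.14] [cite: GreenbergVatsal2000, p. 2 (1)–(2), §2 Prop. (2.8)]
[cite: Washington1997, §13.2] -/
theorem finite_selmerInfty_pTorsion_of_multiplicative_surjective_of_unitCoeff
    (hKW : Wuthrich2014.kato_charIdeal_dvd_multiplicative_of_surjective)
    (W : WeierstrassCurve ℚ) [W.IsElliptic] [W.IsGloballyMinimal] {p : ℕ} [Fact p.Prime]
    (hp : p ≠ 2) (hmult : W.HasMultiplicativeReductionAtPrime p)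
    (hsurj : ∀ n : ℕ, W.HasSurjectiveModNGaloisRep (p ^ n : ℕ))
    {N : ℕ} [NeZero N] (f : CuspForm (Gamma0 N) 2) (hf : IsNewformOf W f)
    (ϖ : ℚ) (hϖ : (ϖ : ℝ) * W.realPeriodRat = plusPeriod f) (L : PowerSeries ℚ_[p])
    (hLns : ¬ W.HasSplitMultiplicativeReductionAtPrime p → IsMultPAdicLFunctionOf f p (-1) L)
    (hLs : W.HasSplitMultiplicativeReductionAtPrime p → IsSplitMultPAdicLFunctionOf f p L)
    (hunit : ∃ n : ℕ, ‖PowerSeries.coeff n (PowerSeries.C (ϖ : ℚ_[p]) * L)‖ = 1)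
    (κ : ZpExtension ℚ p) (hκ : κ.IsCyclotomic) :
    Set.Finite {s : W.selmerInfty κ | p • s = 0} := by
  -- (1) the normalised cyclotomic pair `(κ₀, γ₀)` and its Iwasawa module `X₀ = Hom(Sel_∞, ℚ/ℤ)`
  obtain ⟨κ₀, hκ₀, γ₀, hγ₀, hγ₀'⟩ := exists_isCyclotomic_isTopGenerator_isCyclotomicVariable_holds p
  set D₀ : W.SelmerDualData κ₀ γ₀ := W.selmerDualData κ₀ hγ₀ with hD₀def
  -- (2) Kato's divisibility (Wuthrich 2014 Thm. 3 / Cor. 19, first case): torsion + the two clauses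
  obtain ⟨hX₀, hns, hs⟩ := hKW W p hp hmult hsurj hκ₀ hγ₀ hγ₀' hf D₀ ϖ hϖ
  have hnu : ∀ (g : IwasawaAlgebra p) (m : ℕ),
      ‖((PowerSeries.coeff m g : ℤ_[p]) : ℚ_[p])‖ = 1 → IsUnit (PowerSeries.coeff m g) := fun g m h ↦ by
    rw [PadicInt.isUnit_iff, ← PadicInt.padic_norm_e_of_padicInt]
    exact h
  obtain ⟨n, hn⟩ := hunit
  -- (3) the certificate: some coefficient of some `g ∈ char X₀` is a `p`-adic unit
  have hcert : ∃ g ∈ D₀.charIdeal, ∃ m : ℕ, IsUnit (PowerSeries.coeff m g) := by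
    by_cases hsplit : W.HasSplitMultiplicativeReductionAtPrime p
    · -- split prime: `ι(T·g) = ϖ·L`; the index `0` is excluded (`coeff₀(T·g) = 0`)
      obtain ⟨g, hg, hιg⟩ := hs hsplit L (hLs hsplit)
      refine ⟨g, hg, ?_⟩
      cases n with
      | zero =>
        exfalso
        rw [← hιg, PowerSeries.coeff_map, PowerSeries.coeff_zero_X_mul, map_zero, norm_zero] at hn
        exact zero_ne_one hn
      | succ m =>
        refine ⟨m, hnu g m ?_⟩
        have hcoeff : PowerSeries.coeff (m + 1) (PowerSeries.C (ϖ : ℚ_[p]) * L) =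
            ((PowerSeries.coeff m g : ℤ_[p]) : ℚ_[p]) := by
          rw [← hιg, PowerSeries.coeff_map, PowerSeries.coeff_succ_X_mul]; rfl
        rw [← hcoeff]; exact hn
    · -- non-split prime: `ι g = ϖ·L`
      obtain ⟨g, hg, hιg⟩ := hns hsplit L (hLns hsplit)
      refine ⟨g, hg, n, hnu g n ?_⟩
      have hcoeff : PowerSeries.coeff n (PowerSeries.C (ϖ : ℚ_[p]) * L) =
          ((PowerSeries.coeff n g : ℤ_[p]) : ℚ_[p]) := by
        rw [← hιg, PowerSeries.coeff_map]; rfl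
      rw [← hcoeff]; exact hn
  obtain ⟨g, hg, m, hm⟩ := hcert
  -- (4)–(6) `μ(X₀) = 0` ⟹ f.g./`ℤ_p` ⟹ `X₀/p` finite ⟹ `Sel_∞[p]` finite, at `κ₀`
  have hfin₀ : Set.Finite {s : W.selmerInfty κ₀ | p • s = 0} :=
    finite_selmerInfty_pTorsion_of_mem_charIdeal_of_isUnit_coeff W κ₀ hκ₀ hγ₀ hX₀ hg hm
  -- (7) transport to `κ` (`ker κ₀ = ker κ`)
  exact WildFineSelmerOrdinaryUnitAnchor.finite_pTorsion_selmerGroupOver_of_eq W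
    (hκ₀.kerSubgroup_eq hκ) hfin₀

/-! ## §2 The per-row road: Upper at a wild row from ONE congruent multiplicative big-image anchor -/

/-- **The congruence road with a MULTIPLICATIVE BIG-IMAGE ANCHOR, row form (the Elkies rows).** Let
`W/ℚ` be a row of the Conj-A crux of route K9: globally minimal, `r_an = 0`, `ClassO6 W 3` (additive,
potentially good, wild at `3`), `W[3]` irreducible. Suppose ONE globally minimal `W′/ℚ` is given with
`W′[3] ≃ W[3]` as Galois modules (`O6.ModPCongruent W′ W 3`), MULTIPLICATIVE at `3`, with
`ρ̄_{W′,3^n}` onto for every `n`, together with its newform `f`, `ϖ` (`ϖ·Ω_{W′} = Ω⁺_f`), its `3`-adic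
`L`-function `L` (non-split resp. split normalisation, guarded by the reduction type) and ONE unit
coefficient of `ϖ·L`. Then `ord₃ #Ш(E) ≤ ord₃ #Ш(E)_an` (`MissingUpperBoundAt W 3`) — below the named
facts Lim–Sujatha 2018 Prop. 3.2 (`hLS`, p445851), Kato's fine-Selmer reading of 14.5 (3) (`hKatoA`,
p420034), Kato–Wuthrich multiplicative divisibility (`hKW`), GZK (`hGZK`) and modularity (`hmod`).
Chain: §1 ⟹ `Sel_{3^∞}(E′/ℚ^cyc)[3]` finite for every cyclotomic datum ⟹ (A) at `(E′,3)` ⟹ (A) at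
`(E,3)` ⟹ Upper (k9-c4 g3's
`WildFineSelmerCongruenceFact.missingUpperBoundAt_wild_of_congruent_of_finite_selmerInfty_pTorsion`).
[cite: LimSujatha2018, §3 Prop. 3.2] [cite: Wuthrich2014, Thm. 3 (p. 383); Cor. 19 (p. 398–399)]
[cite: Kato2004Asterisque, Thm. 14.5 (3)] [cite: GreenbergVatsal2000, §2 Prop. (2.8)] -/
theorem missingUpperBoundAt_wild_of_multiplicativeSurjectiveAnchor
    (hLS : LimSujatha2018.prop32_fineSelmerDual_moduleFinite_iff_of_torsionIso)
    (hKatoA :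
      Kato2004.rankZero_padicValNat_sha_add_padicValNat_tamagawa_le_of_additive_potGood_of_irreducible_of_fineSelmerDual_fg)
    (hKW : Wuthrich2014.kato_charIdeal_dvd_multiplicative_of_surjective)
    (hGZK : rank_eq_analyticRank_of_analyticRank_le_one) (hmod : hasEntireLFunction_rat)
    (W : WeierstrassCurve ℚ) [W.IsElliptic] [W.IsGloballyMinimal] [Fact (3 : ℕ).Prime]
    (hr : W.analyticRank = 0) (hO : ClassO6 W 3) (hirr : W.HasIrreducibleModPGaloisRep 3)
    (W' : WeierstrassCurve ℚ) [W'.IsElliptic] [W'.IsGloballyMinimal] (hcong : ModPCongruent W' W 3)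
    (hmult' : W'.HasMultiplicativeReductionAtPrime 3)
    (hsurj' : ∀ n : ℕ, W'.HasSurjectiveModNGaloisRep (3 ^ n : ℕ))
    {N : ℕ} [NeZero N] (f : CuspForm (Gamma0 N) 2) (hf : IsNewformOf W' f)
    (ϖ : ℚ) (hϖ : (ϖ : ℝ) * W'.realPeriodRat = plusPeriod f) (L : PowerSeries ℚ_[3])
    (hLns : ¬ W'.HasSplitMultiplicativeReductionAtPrime 3 → IsMultPAdicLFunctionOf f 3 (-1) L)
    (hLs : W'.HasSplitMultiplicativeReductionAtPrime 3 → IsSplitMultPAdicLFunctionOf f 3 L)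
    (hunit : ∃ n : ℕ, ‖PowerSeries.coeff n (PowerSeries.C (ϖ : ℚ_[3]) * L)‖ = 1) :
    MissingUpperBoundAt W 3 :=
  WildFineSelmerCongruenceFact.missingUpperBoundAt_wild_of_congruent_of_finite_selmerInfty_pTorsion
    hLS hKatoA hGZK hmod W hr hO hirr
    ⟨W', ‹W'.IsElliptic›, hcong, fun κ hκ ↦
      finite_selmerInfty_pTorsion_of_multiplicative_surjective_of_unitCoeff hKW W' (by decide) hmult'
        hsurj' f hf ϖ hϖ L hLns hLs hunit κ hκ⟩

/-- **(A) at the anchor itself, `∃`-form** (the currency (i) of the other anchor files and of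
Lim–Sujatha's transfer): under `hKW`, a globally minimal `W′/ℚ`, `p ≠ 2` multiplicative with
`ρ̄_{W′,p^n}` onto for all `n`, newform/period data, its `p`-adic `L`-function and one unit coefficient
of `ϖ·L` give, for every cyclotomic datum `κ`, a fine-Selmer dual datum finitely generated over `ℤ_p`
(§1, then k9-c4's unconditional `conjA_rat_of_finite_selmerInfty_pTorsion`).
[cite: Wuthrich2014, Thm. 3 (p. 383); Cor. 19 (p. 398–399)] [cite: CoatesSujatha2005, §3]
[cite: GreenbergVatsal2000, §2 Prop. (2.8)] -/
theorem conjA_of_multiplicative_surjective_of_unitCoeff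
    (hKW : Wuthrich2014.kato_charIdeal_dvd_multiplicative_of_surjective)
    (W : WeierstrassCurve ℚ) [W.IsElliptic] [W.IsGloballyMinimal] {p : ℕ} [Fact p.Prime]
    (hp : p ≠ 2) (hmult : W.HasMultiplicativeReductionAtPrime p)
    (hsurj : ∀ n : ℕ, W.HasSurjectiveModNGaloisRep (p ^ n : ℕ))
    {N : ℕ} [NeZero N] (f : CuspForm (Gamma0 N) 2) (hf : IsNewformOf W f)
    (ϖ : ℚ) (hϖ : (ϖ : ℝ) * W.realPeriodRat = plusPeriod f) (L : PowerSeries ℚ_[p])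
    (hLns : ¬ W.HasSplitMultiplicativeReductionAtPrime p → IsMultPAdicLFunctionOf f p (-1) L)
    (hLs : W.HasSplitMultiplicativeReductionAtPrime p → IsSplitMultPAdicLFunctionOf f p L)
    (hunit : ∃ n : ℕ, ‖PowerSeries.coeff n (PowerSeries.C (ϖ : ℚ_[p]) * L)‖ = 1) :
    ∀ (κ : ZpExtension ℚ p), κ.IsCyclotomic →
      ∃ (γ : Field.absoluteGaloisGroup ℚ) (D : W.FineSelmerDualData κ γ),
        Module.Finite ℤ_[p] (RestrictScalars ℤ_[p] (IwasawaAlgebra p) D.X) :=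
  fun κ hκ ↦ WildFineSelmerOrdinaryAnchor.conjA_rat_of_finite_selmerInfty_pTorsion W
    (fun κ' hκ' ↦ finite_selmerInfty_pTorsion_of_multiplicative_surjective_of_unitCoeff hKW W hp hmult
      hsurj f hf ϖ hϖ L hLns hLs hunit κ' hκ') κ hκ

end Summit.BirchSwinnertonDyer.BirchSwinnertonDyer.Theorems.WildFineSelmerMultiplicativeSurjectiveAnchor

end
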